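import Literature.Analysis.FunctionSpaces.TorusHolderBridge
import Mathlib.Analysis.Normed.Group.Tannery
import HarnessLib

/-!
# Series of Hölder-continuous fields: `C^{0,r}` norms of pointwise sums and continuity in time
(route `AnomalousDissipation/SolenoidalFractalHomogenisation`, crux K3 = stmt-AnomalousDissipation-19073
`PermissibleFractalCarrier`, towards the registered stub `stub_regular`; support seat ad-sawtooth-support g7)

Generic tools for summing the levels of a fractal shear carrier:

* `eSupNorm_tsum_le`, `eHolderNorm_tsum_le`, `eBoundedHolderNorm_tsum_le` — the `C^{0,r}` norm of a
  pointwise-summable series is at most the sum of the norms (countable subadditivity);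
* `eBoundedHolderNorm_tsum_le_ofReal_tsum` — the same against real summable majorants;
* `continuousInHolderOn_tsum` — a series of fields, each continuous in time in `C^{0,r}` and dominated by a
  summable real sequence, sums to a field continuous in time with values in `C^{0,r}` (Tannery / dominated
  convergence for series).
-/

noncomputable section

set_option linter.dupNamespace false

namespace Summit.AnomalousDissipation.AnomalousDissipation.Theorems.SolenoidalFractalHomogenisation.PermissibleCarrier

open Set Filter Topology
open scoped ENNReal NNReal
open Literature.Analysis.FunctionSpaces

section Tsum

variable {X : Type*} [MetricSpace X] {Y : Type*} [NormedAddCommGroup Y]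

omit [MetricSpace X] in
/-- The sup norm of a pointwise series is at most the series of the sup norms. [folklore] -/
theorem eSupNorm_tsum_le (f : ℕ → X → Y) :
    eSupNorm (fun x => ∑' m, f m x) ≤ ∑' m, eSupNorm (f m) := by
  refine iSup_le fun x => ?_
  exact enorm_tsum_le_tsum_enorm.trans (ENNReal.tsum_le_tsum fun m => enorm_le_eSupNorm (f m) x)

/-- The Hölder seminorm of a pointwise-summable series is at most the series of the Hölder seminorms.
[cite: GilbargTrudinger2001, §4.1 (Hölder seminorms; subadditivity)] -/
theorem eHolderNorm_tsum_le {r : ℝ≥0} (f : ℕ → X → Y) (hf : ∀ x, Summable fun m => f m x) :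
    eHolderNorm r (fun x => ∑' m, f m x) ≤ ∑' m, eHolderNorm r (f m) := by
  rcases eq_or_ne (∑' m, eHolderNorm r (f m)) ∞ with hT | hT
  · rw [hT]; exact le_top
  have hm : ∀ m, MemHolder r (f m) := fun m =>
    eHolderNorm_ne_top.1 (ENNReal.ne_top_of_tsum_ne_top hT m)
  set C : ℕ → ℝ≥0 := fun m => nnHolderNorm r (f m) with hC
  have hco : ∀ m, eHolderNorm r (f m) = (C m : ℝ≥0∞) := fun m =>
    ((hm m).coe_nnHolderNorm_eq_eHolderNorm).symm
  have hT' : ∑' m, (C m : ℝ≥0∞) ≠ ∞ := by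
    have e : ∑' m, (C m : ℝ≥0∞) = ∑' m, eHolderNorm r (f m) := tsum_congr fun m => (hco m).symm
    rw [e]; exact hT
  have hsumC : Summable C := ENNReal.tsum_coe_ne_top_iff_summable.1 hT'
  have hH : HolderWith (∑' m, C m) r (fun x => ∑' m, f m x) := by
    intro x y
    have e1 : edist (∑' m, f m x) (∑' m, f m y) = ‖∑' m, (f m x - f m y)‖ₑ := by
      rw [edist_eq_enorm_sub, (hf x).tsum_sub (hf y)]
    rw [e1, ENNReal.coe_tsum hsumC, ← ENNReal.tsum_mul_right]
    refine enorm_tsum_le_tsum_enorm.trans (ENNReal.tsum_le_tsum fun m => ?_)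
    rw [← edist_eq_enorm_sub]
    exact (hm m).holderWith x y
  calc eHolderNorm r (fun x => ∑' m, f m x) ≤ ((∑' m, C m : ℝ≥0) : ℝ≥0∞) := hH.eHolderNorm_le
    _ = ∑' m, (C m : ℝ≥0∞) := ENNReal.coe_tsum hsumC
    _ = ∑' m, eHolderNorm r (f m) := tsum_congr fun m => (hco m).symm

/-- **Countable subadditivity of the `C^{0,r}` norm**: for a pointwise-summable series,
`‖Σ fₘ‖_{C^{0,r}} ≤ Σ ‖fₘ‖_{C^{0,r}}`. [cite: GilbargTrudinger2001, §4.1] -/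
theorem eBoundedHolderNorm_tsum_le {r : ℝ≥0} (f : ℕ → X → Y) (hf : ∀ x, Summable fun m => f m x) :
    eBoundedHolderNorm r (fun x => ∑' m, f m x) ≤ ∑' m, eBoundedHolderNorm r (f m) := by
  rw [eBoundedHolderNorm]
  refine (add_le_add (eSupNorm_tsum_le f) (eHolderNorm_tsum_le f hf)).trans (le_of_eq ?_)
  rw [← ENNReal.tsum_add]
  rfl

/-- The same against real summable majorants: `‖fₘ‖_{C^{0,r}} ≤ Bₘ`, `Σ Bₘ < ∞` gives
`‖Σ fₘ‖_{C^{0,r}} ≤ Σ Bₘ`. [folklore] -/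
theorem eBoundedHolderNorm_tsum_le_ofReal_tsum {r : ℝ≥0} (f : ℕ → X → Y) (hf : ∀ x, Summable fun m => f m x)
    {B : ℕ → ℝ} (hB0 : ∀ m, 0 ≤ B m) (hB : Summable B)
    (h : ∀ m, eBoundedHolderNorm r (f m) ≤ ENNReal.ofReal (B m)) :
    eBoundedHolderNorm r (fun x => ∑' m, f m x) ≤ ENNReal.ofReal (∑' m, B m) := by
  rw [ENNReal.ofReal_tsum_of_nonneg hB0 hB]
  exact (eBoundedHolderNorm_tsum_le f hf).trans (ENNReal.tsum_le_tsum h)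

end Tsum

section Time

variable {X : Type*} [MetricSpace X] {Y : Type*} [NormedAddCommGroup Y] [NormedSpace ℝ Y]

/-- `‖f - g‖_{C^{0,r}} ≤ ‖f‖_{C^{0,r}} + ‖g‖_{C^{0,r}}`. [folklore] -/
theorem eBoundedHolderNorm_sub_le (r : ℝ≥0) (f g : X → Y) :
    eBoundedHolderNorm r (f - g) ≤ eBoundedHolderNorm r f + eBoundedHolderNorm r g := by
  have hneg : eBoundedHolderNorm r (-g) = eBoundedHolderNorm r g := by
    rw [show -g = (-1 : ℝ) • g by simp, eBoundedHolderNorm_const_smul]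
    simp
  rw [sub_eq_add_neg, ← hneg]
  exact eBoundedHolderNorm_add_le _ _

/-- **Continuity in time of a dominated series of `C^{0,r}`-continuous fields** (Tannery's theorem for the
`C^{0,r}` norm): if every `uₘ` is continuous on `S` in the `C^{0,r}` norm, `‖uₘ(t)‖_{C^{0,r}} ≤ bₘ` on `S` with
`bₘ ≥ 0`, `Σ bₘ < ∞`, and the series converges pointwise on `S`, then `t ↦ Σₘ uₘ(t)` is continuous on `S` with
values in `C^{0,r}`. [cite: LellisSzekelyhidi2013, §2 (the space C(I; C^α))] -/
theorem continuousInHolderOn_tsum {S : Set ℝ} {r : ℝ≥0} (u : ℕ → ℝ → X → Y) {b : ℕ → ℝ} (hb0 : ∀ m, 0 ≤ b m)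
    (hb : Summable b) (hsum : ∀ t ∈ S, ∀ x, Summable fun m => u m t x)
    (hbd : ∀ m, ∀ t ∈ S, eBoundedHolderNorm r (u m t) ≤ ENNReal.ofReal (b m))
    (hcont : ∀ m, ∀ t₀ ∈ S, Tendsto (fun t => eBoundedHolderNorm r (u m t - u m t₀)) (𝓝[S] t₀) (𝓝 0)) :
    ContinuousInHolderOn S r (fun t x => ∑' m, u m t x) := by
  refine ⟨fun t ht => ?_, fun t₀ ht₀ => ?_⟩
  · -- membership in `C^{0,r}_b`
    have h := eBoundedHolderNorm_tsum_le_ofReal_tsum (fun m => u m t) (hsum t ht) hb0 hb (fun m => hbd m t ht)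
    exact lt_of_le_of_lt h ENNReal.ofReal_lt_top
  · -- continuity at `t₀` within `S`: real sizes of the differences
    set g : ℝ → ℕ → ℝ := fun t m => (eBoundedHolderNorm r (u m t - u m t₀)).toReal with hg
    have hfin : ∀ t ∈ S, ∀ m, eBoundedHolderNorm r (u m t - u m t₀) ≤ ENNReal.ofReal (b m + b m) := by
      intro t ht m
      refine (eBoundedHolderNorm_sub_le r _ _).trans ?_
      rw [ENNReal.ofReal_add (hb0 m) (hb0 m)]
      exact add_le_add (hbd m t ht) (hbd m t₀ ht₀)
    have hne : ∀ t ∈ S, ∀ m, eBoundedHolderNorm r (u m t - u m t₀) ≠ ⊤ := fun t ht m =>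
      ne_top_of_le_ne_top ENNReal.ofReal_ne_top (hfin t ht m)
    have hgle : ∀ t ∈ S, ∀ m, g t m ≤ b m + b m := fun t ht m =>
      ENNReal.toReal_le_of_le_ofReal (by linarith [hb0 m]) (hfin t ht m)
    have hg0 : ∀ t m, 0 ≤ g t m := fun t m => ENNReal.toReal_nonneg
    -- Tannery: `Σₘ g t m → 0`
    have hT : Tendsto (fun t => ∑' m, g t m) (𝓝[S] t₀) (𝓝 (∑' _ : ℕ, (0 : ℝ))) := by
      refine tendsto_tsum_of_dominated_convergence (hb.add hb) (fun m => ?_) ?_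
      · have h := (ENNReal.tendsto_toReal ENNReal.zero_ne_top).comp (hcont m t₀ ht₀)
        rw [ENNReal.toReal_zero] at h
        exact h
      · filter_upwards [self_mem_nhdsWithin] with t ht m
        rw [Real.norm_eq_abs, abs_of_nonneg (hg0 t m)]
        exact hgle t ht m
    rw [tsum_zero] at hT
    have hT' : Tendsto (fun t => ENNReal.ofReal (∑' m, g t m)) (𝓝[S] t₀) (𝓝 0) := by
      have h := (ENNReal.continuous_ofReal.tendsto 0).comp hT
      rwa [ENNReal.ofReal_zero] at h
    -- squeeze
    refine tendsto_of_tendsto_of_tendsto_of_le_of_le' tendsto_const_nhds hT' (Eventually.of_forall fun t => bot_le) ?_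
    filter_upwards [self_mem_nhdsWithin] with t ht
    have hdiff : ((fun x => ∑' m, u m t x) - fun x => ∑' m, u m t₀ x) = fun x => ∑' m, (u m t - u m t₀) x := by
      funext x
      simp only [Pi.sub_apply]
      rw [← (hsum t ht x).tsum_sub (hsum t₀ ht₀ x)]
    rw [hdiff]
    have hsum' : ∀ x, Summable fun m => (u m t - u m t₀) x := fun x => by
      simpa only [Pi.sub_apply] using (hsum t ht x).sub (hsum t₀ ht₀ x)
    have hgsum : Summable (g t) := (hb.add hb).of_nonneg_of_le (hg0 t) (hgle t ht)
    refine eBoundedHolderNorm_tsum_le_ofReal_tsum _ hsum' (hg0 t) hgsum fun m => ?_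
    rw [ENNReal.ofReal_toReal (hne t ht m)]

end Time

end Summit.AnomalousDissipation.AnomalousDissipation.Theorems.SolenoidalFractalHomogenisation.PermissibleCarrier

end
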